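import Mathlib.RingTheory.Etale.Field
import Mathlib.RingTheory.Discriminant
import Mathlib.RingTheory.Localization.NormTrace
import Mathlib.RingTheory.Smooth.Flat
import Mathlib.RingTheory.Flat.TorsionFree
import Mathlib.LinearAlgebra.FreeModule.PID
import Mathlib.LinearAlgebra.Matrix.Nondegenerate
import HarnessLib

/-!
# Finite étale algebras: unit discriminant, trace-dual basis, and the lattice in a localisation

Topic: `Literature/RingTheory/Etale`. The implication (i) ⇒ (iv) of Görtz–Wedhorn II,
Prop. 20.71 (2) — *a finite locally free morphism is an étale cover iff its trace form is
perfect* — in the affine, free case, fully proved from Mathlib's structure theorem for étale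
algebras over a field (`Algebra.FormallyEtale.iff_exists_algEquiv_prod`: finite products of
finite separable extensions) and the non-degeneracy of the trace form of a separable extension
(`traceForm_nondegenerate`; Bourbaki, *Algèbre* V §8.2 Prop. 1):

* `trace_pi_apply` — the trace of a finite product of finite free algebras is the sum of the
  traces;
* `exists_trace_mul_ne_zero_of_formallyEtale` — a finite étale algebra over a field has
  non-degenerate trace form;
* `isUnit_discr_of_formallyEtale` — a finite free formally étale `A`-algebra `B` has unit
  discriminant (reduce modulo a maximal ideal containing it; `trace_baseChange_tmul`);
* `exists_traceDual_of_isUnit_discr` — hence a trace-dual basis `bd`, `Tr(bdᵢ bⱼ) = δᵢⱼ`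
  (that a finite étale algebra over a principal ideal domain is *free* — étale ⇒ smooth ⇒ flat ⇒
  torsion-free ⇒ free — is pure instance synthesis ending in Mathlib's
  `Module.free_of_finite_type_torsion_free'`; it is not restated here, and the imports
  `RingTheory.Smooth.Flat`, `RingTheory.Flat.TorsionFree`, `LinearAlgebra.FreeModule.PID` are kept
  so that importing this module supplies that chain);
* the *lattice data* of `B` inside a localisation `N = B_M` over `Λ = A_M`
  (`trace_localization_dual`, `mem_range_iff_repr`, `mem_range_iff_trace`): the dual relations
  persist, the image of `B` is cut out by "coordinates in `A`" in the localised basis, and it is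
  self-dual — `x` comes from `B` iff `Tr_{N/Λ}(x y) ∈ A` for all `y` from `B`.

These are the étale inputs of the lattice proof that `ℙ¹_k` is simply connected
(`AlgebraicGeometry/FundamentalGroup/ProjectiveLineLattices.lean`), kept free of any dependence
on it. No definitions, no named facts.

## Sources

* U. Görtz, T. Wedhorn, *Algebraic Geometry II* (2023), Prop. 20.71 (2) and the proof of
  Thm. 20.114. [GortzWedhorn2023]
* N. Bourbaki, *Algèbre*, Ch. V §8.2, Prop. 1 (separable ⟺ trace form non-degenerate).
-/

noncomputable section

open Module Algebra TensorProduct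

namespace Literature.RingTheory.Etale

universe u

/-! ## The trace of a finite product of finite free algebras -/

section PiTrace

variable {R : Type*} [CommRing R] {I : Type*} [Fintype I] (A : I → Type*)
  [∀ i, CommRing (A i)] [∀ i, Algebra R (A i)] [∀ i, Module.Free R (A i)]
  [∀ i, Module.Finite R (A i)]

/-- The trace of `Πᵢ Aᵢ` over `R` is the sum of the traces of the factors (block-diagonal
multiplication matrices). [folklore] -/
theorem trace_pi_apply (x : Π i, A i) :
    Algebra.trace R (Π i, A i) x = ∑ i, Algebra.trace R (A i) (x i) := by
  classical
  let β := fun i => Module.Free.chooseBasis R (A i)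
  let B := Pi.basis β
  rw [Algebra.trace_eq_matrix_trace B, Matrix.trace]
  simp_rw [Algebra.trace_eq_matrix_trace (β _), Matrix.trace, Matrix.diag,
    Algebra.leftMulMatrix_eq_repr_mul]
  rw [← Finset.univ_sigma_univ, Finset.sum_sigma]
  refine Finset.sum_congr rfl fun i _ => Finset.sum_congr rfl fun l _ => ?_
  have hmul : x * B ⟨i, l⟩ = (LinearMap.single R A i) (x i * β i l) := by
    rw [Pi.basis_apply]
    ext j
    by_cases hj : j = i
    · subst hj; simp
    · simp [hj, Pi.mul_apply]
  rw [hmul, Pi.basis_repr]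
  simp

end PiTrace

/-! ## Finite étale algebras over a field have a non-degenerate trace form -/

/-- **Finite étale algebras over a field have non-degenerate trace form** (Görtz–Wedhorn II,
Prop. 20.71 (2), (i) ⇒ (iv), over a field; Bourbaki A V §8.2 Prop. 1 for field extensions):
if `A` is a finite étale algebra over the field `K` and `x ≠ 0`, then `Tr_{A/K}(x y) ≠ 0` for
some `y`. Proof: `A ≅ Π Lᵢ` with `Lᵢ/K` finite separable (Mathlib
`Algebra.FormallyEtale.iff_exists_algEquiv_prod`), the trace is the sum of the traces of the
factors, and each `Tr_{Lᵢ/K}` is non-degenerate. [cite: GortzWedhorn2023, Prop. 20.71 (2)] -/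
theorem exists_trace_mul_ne_zero_of_formallyEtale (K A : Type u) [Field K] [CommRing A]
    [Algebra K A] [Module.Finite K A] [Algebra.FormallyEtale K A] {x : A} (hx : x ≠ 0) :
    ∃ y, Algebra.trace K A (x * y) ≠ 0 := by
  classical
  obtain ⟨I, hI, Ai, _, _, e, hsep⟩ := (Algebra.FormallyEtale.iff_exists_algEquiv_prod K A).mp ‹_›
  haveI := Fintype.ofFinite I
  haveI : ∀ i, Module.Finite K (Ai i) := fun i =>
    Module.Finite.of_surjective ((LinearMap.proj i).comp e.toLinearEquiv.toLinearMap)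
      (fun a => ⟨e.symm (Pi.single i a), by simp⟩)
  have hx' : e x ≠ 0 := by simpa using hx
  obtain ⟨i, hi⟩ : ∃ i, e x i ≠ 0 := by
    by_contra h
    push Not at h
    exact hx' (funext h)
  obtain ⟨n, hn⟩ : ∃ n, Algebra.trace K (Ai i) (e x i * n) ≠ 0 := by
    by_contra h
    push Not at h
    exact hi ((traceForm_nondegenerate K (Ai i)).1 _ fun n => by
      simpa [Algebra.traceForm_apply] using h n)
  refine ⟨e.symm (Pi.single i n), ?_⟩
  rw [← Algebra.trace_eq_of_algEquiv e, map_mul, AlgEquiv.apply_symm_apply, trace_pi_apply]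
  rw [Finset.sum_eq_single i]
  · simpa using hn
  · intro j _ hj
    simp [Pi.single_eq_of_ne hj]
  · intro h; exact absurd (Finset.mem_univ i) h

/-! ## Finite étale algebras have unit discriminant and a trace-dual basis -/

section Discr

variable {A B : Type u} [CommRing A] [CommRing B] [Algebra A B]

/-- Base change of the trace: `Tr_{(κ ⊗ B)/κ}(1 ⊗ z) = Tr_{B/A}(z)` in `κ`, for `B` finite free
over `A`. [folklore] -/
theorem trace_baseChange_tmul (κ : Type u) [CommRing κ] [Algebra A κ] [Module.Free A B]
    [Module.Finite A B] (z : B) :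
    Algebra.trace κ (κ ⊗[A] B) (1 ⊗ₜ z) = algebraMap A κ (Algebra.trace A B z) := by
  rw [Algebra.trace_apply, Algebra.trace_apply, ← LinearMap.trace_baseChange]
  congr 1
  refine TensorProduct.AlgebraTensorModule.ext fun a y => ?_
  simp [LinearMap.baseChange_tmul]

/-- **A finite free étale algebra has unit discriminant** (Görtz–Wedhorn II, Prop. 20.71 (2),
(i) ⇒ (iv): the trace form of an étale cover is perfect): if `B` is a finite free formally étale
`A`-algebra with basis `b`, then `discr_A(b)` is a unit of `A`. Proof: otherwise it lies in a
maximal ideal `𝔪`; base-changing to `κ = A/𝔪` the trace matrix of the `κ`-basis `1 ⊗ b` is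
singular, giving `0 ≠ x ∈ κ ⊗ B` with `Tr(x ·) = 0`, contradicting the non-degeneracy of the
trace form of the finite étale `κ`-algebra `κ ⊗ B`. [cite: GortzWedhorn2023, Prop. 20.71 (2)] -/
theorem isUnit_discr_of_formallyEtale [Algebra.FormallyEtale A B] [Module.Finite A B]
    {ι : Type*} [Fintype ι] [DecidableEq ι] (b : Basis ι A B) : IsUnit (Algebra.discr A b) := by
  haveI := Module.Free.of_basis b
  by_contra hunit
  obtain ⟨m, hm, hmem⟩ := exists_max_ideal_of_mem_nonunits (mem_nonunits_iff.mpr hunit)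
  let κ := A ⧸ m
  letI : Field κ := Ideal.Quotient.field m
  let bκ : Basis ι κ (κ ⊗[A] B) := Algebra.TensorProduct.basis κ b
  -- the trace matrix of `bκ` is the reduction of the trace matrix of `b`
  have hmat : Algebra.traceMatrix κ bκ = (Algebra.traceMatrix A b).map (algebraMap A κ) := by
    ext i j
    simp only [Algebra.traceMatrix_apply, Algebra.traceForm_apply, Matrix.map_apply, bκ,
      Algebra.TensorProduct.basis_apply, Algebra.TensorProduct.tmul_mul_tmul, mul_one]
    exact trace_baseChange_tmul κ (b i * b j)
  have hdet : (Algebra.traceMatrix κ bκ).det = 0 := by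
    rw [hmat]
    change ((algebraMap A κ).mapMatrix (Algebra.traceMatrix A b)).det = 0
    rw [← RingHom.map_det, ← Algebra.discr_def]
    exact Ideal.Quotient.eq_zero_iff_mem.mpr hmem
  obtain ⟨v, hv0, hv⟩ := Matrix.exists_mulVec_eq_zero_iff.mpr hdet
  -- the corresponding element of `κ ⊗ B` is orthogonal to everything
  set x : κ ⊗[A] B := ∑ j, v j • bκ j with hxdef
  have hx0 : x ≠ 0 := by
    intro h
    apply hv0
    funext j
    have := congrArg (fun y => bκ.repr y j) h
    simp only [hxdef, map_sum, map_smul, Finset.sum_apply, Finsupp.coe_finsetSum,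
      Finsupp.coe_smul, Pi.smul_apply, bκ.repr_self, Finsupp.single_apply, smul_eq_mul,
      mul_ite, mul_one, mul_zero, Finset.sum_ite_eq', Finset.mem_univ, if_true, map_zero,
      Finsupp.coe_zero, Pi.zero_apply] at this
    exact this
  have horth : ∀ i, Algebra.trace κ (κ ⊗[A] B) (bκ i * x) = 0 := by
    intro i
    have := congrFun hv i
    rw [Matrix.mulVec, dotProduct] at this
    simp only [Pi.zero_apply] at this
    rw [hxdef, Finset.mul_sum, map_sum]
    simp only [mul_smul_comm, map_smul, smul_eq_mul]
    rw [← this]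
    refine Finset.sum_congr rfl fun j _ => ?_
    rw [Algebra.traceMatrix_apply, Algebra.traceForm_apply, mul_comm]
  obtain ⟨y, hy⟩ := exists_trace_mul_ne_zero_of_formallyEtale κ (κ ⊗[A] B) hx0
  apply hy
  rw [← bκ.sum_repr y, Finset.mul_sum, map_sum]
  refine Finset.sum_eq_zero fun i _ => ?_
  rw [mul_smul_comm, map_smul, mul_comm, horth, smul_zero]

/-- From a unit discriminant: a **trace-dual basis** `bd` of `b`, `Tr(bdᵢ bⱼ) = δᵢⱼ`
(`bd = G⁻¹ b` for the Gram matrix `G = (Tr(bᵢ bⱼ))`). [folklore] -/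
theorem exists_traceDual_of_isUnit_discr {ι : Type*} [Fintype ι] [DecidableEq ι] (b : Basis ι A B)
    (h : IsUnit (Algebra.discr A b)) :
    ∃ bd : ι → B, ∀ i j, Algebra.trace A B (bd i * b j) = if i = j then 1 else 0 := by
  set G := Algebra.traceMatrix A b with hG
  have hGu : IsUnit G := (Matrix.isUnit_iff_isUnit_det G).mpr (by rwa [← Algebra.discr_def])
  refine ⟨fun i => ∑ l, G⁻¹ i l • b l, fun i j => ?_⟩
  rw [Finset.sum_mul, map_sum]
  simp only [smul_mul_assoc, map_smul, smul_eq_mul]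
  have : (G⁻¹ * G) i j = if i = j then 1 else 0 := by
    rw [Matrix.nonsing_inv_mul G ((Matrix.isUnit_iff_isUnit_det G).mp hGu), Matrix.one_apply]
  rw [← this, Matrix.mul_apply]
  refine Finset.sum_congr rfl fun l _ => ?_
  rw [hG, Algebra.traceMatrix_apply, Algebra.traceForm_apply]

end Discr

/-! ## Transport to a localisation: the lattice data of a finite étale algebra -/

section Localization

variable {A B Λ N : Type*} [CommRing A] [CommRing B] [CommRing Λ] [CommRing N]
  [Algebra A B] [Algebra A Λ] [Algebra B N] [Algebra Λ N] [Algebra A N]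
  [IsScalarTower A B N] [IsScalarTower A Λ N]
  (M : Submonoid A) [IsLocalization M Λ] [IsLocalization (Algebra.algebraMapSubmonoid B M) N]
  {ι : Type*} [Fintype ι] [DecidableEq ι] (b : Basis ι A B)

include M

omit [Fintype ι] in
/-- The trace-dual relations survive localisation: `Tr_{N/Λ}(bdᵢ bⱼ) = δᵢⱼ` for the localised
basis. [folklore] -/
theorem trace_localization_dual [Module.Finite A B] {bd : ι → B}
    (hbd : ∀ i j, Algebra.trace A B (bd i * b j) = if i = j then 1 else 0) (i j : ι) :
    Algebra.trace Λ N (algebraMap B N (bd i) * b.localizationLocalization Λ M N j) =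
      if i = j then 1 else 0 := by
  haveI := Module.Free.of_basis b
  rw [Basis.localizationLocalization_apply, ← map_mul,
    Algebra.trace_localization (Rₘ := Λ) (Sₘ := N) A M, hbd]
  split_ifs <;> simp

/-- With a trace-dual family, coordinates are traces: `xⱼ = Tr(x · bdⱼ)`. [folklore] -/
theorem repr_localizationLocalization_eq_trace [Module.Finite A B] {bd : ι → B}
    (hbd : ∀ i j, Algebra.trace A B (bd i * b j) = if i = j then 1 else 0) (x : N) (j : ι) :
    (b.localizationLocalization Λ M N).repr x j =
      Algebra.trace Λ N (x * algebraMap B N (bd j)) := by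
  conv_rhs => rw [← (b.localizationLocalization Λ M N).sum_repr x]
  rw [Finset.sum_mul, map_sum]
  simp only [smul_mul_assoc, map_smul, smul_eq_mul,
    mul_comm (b.localizationLocalization Λ M N _) (algebraMap B N (bd j)),
    trace_localization_dual M b hbd]
  simp

omit [DecidableEq ι] in
/-- **The image of `B` in `N = B_M` is cut out by coordinates**: `x ∈ N` comes from `B` iff all
its coordinates in the localised basis come from `A`. [folklore] -/
theorem mem_range_iff_repr (x : N) :
    x ∈ (algebraMap B N).range ↔
      ∀ i, (b.localizationLocalization Λ M N).repr x i ∈ (algebraMap A Λ).range := by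
  set bN := b.localizationLocalization Λ M N with hbN
  constructor
  · rintro ⟨y, rfl⟩ i
    exact ⟨b.repr y i, (Basis.localizationLocalization_repr_algebraMap Λ M N b y i).symm⟩
  · intro h
    choose a ha using h
    refine ⟨∑ i, a i • b i, ?_⟩
    rw [← bN.sum_repr x, map_sum]
    refine Finset.sum_congr rfl fun i _ => ?_
    rw [← ha i, hbN, Basis.localizationLocalization_apply, IsScalarTower.algebraMap_smul,
      Algebra.smul_def, map_mul, ← IsScalarTower.algebraMap_apply A B N, Algebra.smul_def]

/-- **Self-duality of the image of a finite étale algebra in its localisation**: if `b` has a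
trace-dual family (unit discriminant), then `x ∈ N` comes from `B` iff `Tr_{N/Λ}(x y)` comes from
`A` for every `y` coming from `B`. [folklore] -/
theorem mem_range_iff_trace [Module.Finite A B] {bd : ι → B}
    (hbd : ∀ i j, Algebra.trace A B (bd i * b j) = if i = j then 1 else 0) (x : N) :
    x ∈ (algebraMap B N).range ↔
      ∀ y ∈ (algebraMap B N).range, Algebra.trace Λ N (x * y) ∈ (algebraMap A Λ).range := by
  haveI := Module.Free.of_basis b
  constructor
  · rintro ⟨x₀, rfl⟩ _ ⟨y₀, rfl⟩
    rw [← map_mul, Algebra.trace_localization (Rₘ := Λ) (Sₘ := N) A M]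
    exact ⟨_, rfl⟩
  · intro h
    refine (mem_range_iff_repr (Λ := Λ) M b x).mpr fun i => ?_
    rw [repr_localizationLocalization_eq_trace (Λ := Λ) M b hbd]
    exact h _ ⟨bd i, rfl⟩

end Localization

end Literature.RingTheory.Etale
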